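import Literature.NumberTheory.Automorphic.ResGLnHermitianCone
import Literature.NumberTheory.Automorphic.AutomorphicLieDerivSkewAdjointArchGrowth
import HarnessLib

/-!
# Entry bounds on `GL_n(K_∞)`: the archimedean height, conjugates `g Z gᴴ`, and the entry gauge of
# `g gᴴ`

Topic `NumberTheory/Automorphic`; namespace `Literature.NumberTheory.Automorphic.ResGLnCone`.  Theorems
only (no definition, no named fact, no `sorry`).  Elementary estimates used to bound lifts of cone
forms to `G_∞ = GL_n(K_∞)` polynomially in the archimedean height `H_∞` (`GLn.archHeight`) of
Borel–Jacquet [cite: BorelJacquetCorvallis1979, §1.2]: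

* `toMixed_ofArch`, `norm_entry_le_archHeight`, `archHeight_ofArch_inv` — the entries of `g` and of
  `g⁻¹` are bounded by `H_∞(g, 1)`, which is symmetric under inversion;
* `norm_mul_entry_le`, `norm_conj_entry_le`, `hermSpace_norm_le_of_entry_le`, `hermSpace_norm_conj_le`
  — `‖(g Z gᴴ)_{ij}‖ ≤ (∑ ‖Z_{lm}‖) s²` when the entries of `g` are `≤ s`, and the same for the sup norm
  of the hermitian space `ResGLnCone.hermSpace`;
* `entryGauge_hermSquare_le` — the entry gauge `1 + ∑ (‖(g gᴴ)_{ij}‖ + ‖((g gᴴ)⁻¹)_{ij}‖)` is at most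
  `(1 + 2 n³) s²` (`(g gᴴ)⁻¹ = (g⁻¹)ᴴ g⁻¹`);
* `mul_pow_le_mul_pow_of_le`, `prod_norm_le_pow` — bookkeeping for polynomial bounds.

## References

* A. Borel, H. Jacquet, *Automorphic forms and automorphic representations*, Corvallis (1979), §1.2
  (the height and its archimedean factor). [BorelJacquetCorvallis1979]
* A. Borel, *Introduction aux groupes arithmétiques*, Hermann (1969), §12. [Borel1969]
-/

noncomputable section

open scoped Classical Matrix NNReal
open NumberField NumberField.mixedEmbedding

namespace Literature.NumberTheory.Automorphic

namespace ResGLnCone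

variable {n : ℕ} {K : Type} [Field K] [NumberField K]

/-- The archimedean component of `(g, 1) ∈ GL_n(𝔸_K)` is `g`. [folklore] -/
theorem toMixed_ofArch (hcpt : isCompact_glFiniteIntegralLevel n K) (g : (AutomorphyDatum.gl n K hcpt).arch.carrier) :
    GLn.toMixed n K ((AutomorphyDatum.gl n K hcpt).ofArch g) = (g : GL (Fin n) (mixedSpace K)) :=
  GLn.toMixed_ofInfinite _

/-- **Entries of `g ∈ G_∞` and of `g⁻¹` are bounded by the archimedean height `H_∞(g, 1)`.**
[cite: BorelJacquetCorvallis1979, §1.2] -/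
theorem norm_entry_le_archHeight (hcpt : isCompact_glFiniteIntegralLevel n K)
    (g : (AutomorphyDatum.gl n K hcpt).arch.carrier) (i j : Fin n) :
    ‖((g : GL (Fin n) (mixedSpace K)) : Matrix (Fin n) (Fin n) (mixedSpace K)) i j‖ ≤
        (GLn.archHeight n K ((AutomorphyDatum.gl n K hcpt).ofArch g) : ℝ) ∧
      ‖(((g⁻¹ : (AutomorphyDatum.gl n K hcpt).arch.carrier) : GL (Fin n) (mixedSpace K)) :
          Matrix (Fin n) (Fin n) (mixedSpace K)) i j‖ ≤
        (GLn.archHeight n K ((AutomorphyDatum.gl n K hcpt).ofArch g) : ℝ) := by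
  have h := Finset.le_sup (f := fun ij : Fin n × Fin n =>
    ‖(GLn.toMixed n K ((AutomorphyDatum.gl n K hcpt).ofArch g) : Matrix (Fin n) (Fin n) (mixedSpace K)) ij.1 ij.2‖₊ ⊔
      ‖(((GLn.toMixed n K ((AutomorphyDatum.gl n K hcpt).ofArch g))⁻¹ : GL (Fin n) (mixedSpace K)) :
        Matrix (Fin n) (Fin n) (mixedSpace K)) ij.1 ij.2‖₊) (Finset.mem_univ (i, j))
  rw [toMixed_ofArch] at h
  have h1 : (‖((g : GL (Fin n) (mixedSpace K)) : Matrix (Fin n) (Fin n) (mixedSpace K)) i j‖₊ : ℝ) ≤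
      (GLn.archHeight n K ((AutomorphyDatum.gl n K hcpt).ofArch g) : ℝ) := by
    refine NNReal.coe_le_coe.2 (le_sup_left.trans (h.trans ?_))
    unfold GLn.archHeight
    rw [toMixed_ofArch]
  have h2 : (‖(((g : GL (Fin n) (mixedSpace K))⁻¹ : GL (Fin n) (mixedSpace K)) :
      Matrix (Fin n) (Fin n) (mixedSpace K)) i j‖₊ : ℝ) ≤
      (GLn.archHeight n K ((AutomorphyDatum.gl n K hcpt).ofArch g) : ℝ) := by
    refine NNReal.coe_le_coe.2 (le_sup_right.trans (h.trans ?_))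
    unfold GLn.archHeight
    rw [toMixed_ofArch]
  exact ⟨h1, h2⟩

/-- Entries of the conjugate transpose have the same norms. [folklore] -/
theorem norm_conjTranspose_entry (A : Matrix (Fin n) (Fin n) (mixedSpace K)) (i j : Fin n) :
    ‖Aᴴ i j‖ = ‖A j i‖ := by
  rw [Matrix.conjTranspose_apply, norm_star]

/-- **Entries of `g Z gᴴ`**: `‖(g Z gᴴ)_{ij}‖ ≤ (∑_{l,m} ‖Z_{lm}‖) s²` when the entries of `g` are bounded by
`s ≥ 0`. [folklore] -/
theorem norm_conj_entry_le {g Z : Matrix (Fin n) (Fin n) (mixedSpace K)} {s : ℝ} (hs : 0 ≤ s)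
    (hg : ∀ i j, ‖g i j‖ ≤ s) (i j : Fin n) :
    ‖(g * Z * gᴴ) i j‖ ≤ (∑ l, ∑ m, ‖Z l m‖) * s ^ 2 := by
  have hZ : ∀ m, ‖(g * Z) i m‖ ≤ (∑ l, ‖Z l m‖) * s := fun m => by
    rw [Matrix.mul_apply, Finset.sum_mul]
    refine (norm_sum_le _ _).trans (Finset.sum_le_sum fun l _ => (norm_mul_le _ _).trans ?_)
    rw [mul_comm]
    exact mul_le_mul_of_nonneg_left (hg i l) (norm_nonneg _)
  rw [Matrix.mul_apply]
  calc ‖∑ m, (g * Z) i m * gᴴ m j‖ ≤ ∑ m, ‖(g * Z) i m * gᴴ m j‖ := norm_sum_le _ _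
    _ ≤ ∑ m, ((∑ l, ‖Z l m‖) * s) * s := Finset.sum_le_sum fun m _ =>
        (norm_mul_le _ _).trans (mul_le_mul (hZ m) (by rw [norm_conjTranspose_entry]; exact hg j m)
          (norm_nonneg _) (mul_nonneg (Finset.sum_nonneg fun _ _ => norm_nonneg _) hs))
    _ = (∑ l, ∑ m, ‖Z l m‖) * s ^ 2 := by
        rw [Finset.sum_comm, Finset.sum_mul]
        exact Finset.sum_congr rfl fun m _ => by ring

/-- A hermitian matrix whose entries are bounded by `B ≥ 0` has norm `≤ B` (elementwise sup norm).
[folklore] -/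
theorem hermSpace_norm_le_of_entry_le (v : ResGLnCone.hermSpace n K) {B : ℝ} (hB : 0 ≤ B)
    (h : ∀ i j, ‖(v : Matrix (Fin n) (Fin n) (mixedSpace K)) i j‖ ≤ B) : ‖v‖ ≤ B := by
  have hn : ‖v‖ = ‖(show Fin n → Fin n → mixedSpace K from (v : Matrix (Fin n) (Fin n) (mixedSpace K)))‖ := rfl
  rw [hn]
  exact (pi_norm_le_iff_of_nonneg hB).2 fun i => (pi_norm_le_iff_of_nonneg hB).2 fun j => h i j

/-- **`‖g Z gᴴ‖ ≤ (∑ ‖Z_{lm}‖) s²`** for the hermitian-space norm, entries of `g` bounded by `s ≥ 0`.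
[folklore] -/
theorem hermSpace_norm_conj_le (v : ResGLnCone.hermSpace n K) {g Z : Matrix (Fin n) (Fin n) (mixedSpace K)}
    (hv : (v : Matrix (Fin n) (Fin n) (mixedSpace K)) = g * Z * gᴴ) {s : ℝ} (hs : 0 ≤ s)
    (hg : ∀ i j, ‖g i j‖ ≤ s) : ‖v‖ ≤ (∑ l, ∑ m, ‖Z l m‖) * s ^ 2 := by
  refine hermSpace_norm_le_of_entry_le v (mul_nonneg (Finset.sum_nonneg fun _ _ =>
    Finset.sum_nonneg fun _ _ => norm_nonneg _) (sq_nonneg _)) fun i j => ?_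
  rw [hv]
  exact norm_conj_entry_le hs hg i j

/-- Entries of a product: `‖(A B)_{ij}‖ ≤ n s²` when the entries of `A`, `B` are bounded by `s ≥ 0`.
[folklore] -/
theorem norm_mul_entry_le {A B : Matrix (Fin n) (Fin n) (mixedSpace K)} {s : ℝ} (hs : 0 ≤ s)
    (hA : ∀ i j, ‖A i j‖ ≤ s) (hB : ∀ i j, ‖B i j‖ ≤ s) (i j : Fin n) :
    ‖(A * B) i j‖ ≤ (n : ℝ) * s ^ 2 := by
  rw [Matrix.mul_apply]
  calc ‖∑ l, A i l * B l j‖ ≤ ∑ l, ‖A i l * B l j‖ := norm_sum_le _ _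
    _ ≤ ∑ _l : Fin n, s * s := Finset.sum_le_sum fun l _ =>
        (norm_mul_le _ _).trans (mul_le_mul (hA i l) (hB l j) (norm_nonneg _) hs)
    _ = (n : ℝ) * s ^ 2 := by rw [Finset.sum_const, Finset.card_univ, Fintype.card_fin, nsmul_eq_mul, sq]

/-- **The entry gauge of `g gᴴ` is polynomial in the entries of `g^{±1}`**:
`1 + ∑ (‖(g gᴴ)_{ij}‖ + ‖((g gᴴ)⁻¹)_{ij}‖) ≤ (1 + 2 n³) s²` for `s ≥ 1` bounding the entries of `g` and
`g⁻¹` (`(g gᴴ)⁻¹ = (g⁻¹)ᴴ g⁻¹`). [folklore] -/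
theorem entryGauge_hermSquare_le (g : GL (Fin n) (mixedSpace K)) {s : ℝ} (hs : 1 ≤ s)
    (hg : ∀ i j, ‖(g : Matrix (Fin n) (Fin n) (mixedSpace K)) i j‖ ≤ s)
    (hgi : ∀ i j, ‖((g⁻¹ : GL (Fin n) (mixedSpace K)) : Matrix (Fin n) (Fin n) (mixedSpace K)) i j‖ ≤ s) :
    (1 + ∑ i, ∑ j, (‖((g : Matrix (Fin n) (Fin n) (mixedSpace K)) *
        ((g : Matrix (Fin n) (Fin n) (mixedSpace K)))ᴴ) i j‖ +
      ‖((g : Matrix (Fin n) (Fin n) (mixedSpace K)) *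
        ((g : Matrix (Fin n) (Fin n) (mixedSpace K)))ᴴ)⁻¹ i j‖)) ≤ (1 + 2 * (n : ℝ) ^ 3) * s ^ 2 := by
  have hs0 : 0 ≤ s := zero_le_one.trans hs
  have hs2 : 1 ≤ s ^ 2 := one_le_pow₀ hs
  set gm : Matrix (Fin n) (Fin n) (mixedSpace K) := (g : Matrix (Fin n) (Fin n) (mixedSpace K)) with hgm
  set gi : Matrix (Fin n) (Fin n) (mixedSpace K) :=
    ((g⁻¹ : GL (Fin n) (mixedSpace K)) : Matrix (Fin n) (Fin n) (mixedSpace K)) with hgi'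
  have hinv : (gm * gmᴴ)⁻¹ = giᴴ * gi := by
    rw [Matrix.mul_inv_rev, ← Matrix.conjTranspose_nonsing_inv, hgm, ← Matrix.coe_units_inv, ← hgi']
  have h1 : ∀ i j, ‖(gm * gmᴴ) i j‖ ≤ (n : ℝ) * s ^ 2 := fun i j =>
    norm_mul_entry_le hs0 hg (fun i j => by rw [norm_conjTranspose_entry]; exact hg j i) i j
  have h2 : ∀ i j, ‖(gm * gmᴴ)⁻¹ i j‖ ≤ (n : ℝ) * s ^ 2 := fun i j => by
    rw [hinv]
    exact norm_mul_entry_le hs0 (fun i j => by rw [norm_conjTranspose_entry]; exact hgi j i) hgi i j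
  have hsum : ∑ i, ∑ j, (‖(gm * gmᴴ) i j‖ + ‖(gm * gmᴴ)⁻¹ i j‖) ≤ (n : ℝ) * n * (2 * (n * s ^ 2)) := by
    calc ∑ i, ∑ j, (‖(gm * gmᴴ) i j‖ + ‖(gm * gmᴴ)⁻¹ i j‖)
        ≤ ∑ _i : Fin n, ∑ _j : Fin n, 2 * ((n : ℝ) * s ^ 2) :=
          Finset.sum_le_sum fun i _ => Finset.sum_le_sum fun j _ => by linarith [h1 i j, h2 i j]
      _ = (n : ℝ) * n * (2 * (n * s ^ 2)) := by
          rw [Finset.sum_const, Finset.card_univ, Fintype.card_fin, nsmul_eq_mul, Finset.sum_const,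
            Finset.card_univ, Fintype.card_fin, nsmul_eq_mul, mul_assoc]
  have hn0 : (0 : ℝ) ≤ n := Nat.cast_nonneg n
  nlinarith [hsum, hs2, pow_nonneg hn0 3, mul_nonneg (mul_nonneg hn0 hn0) hn0]

/-- The archimedean height is symmetric under inversion. [folklore] -/
theorem archHeight_ofArch_inv (hcpt : isCompact_glFiniteIntegralLevel n K)
    (g : (AutomorphyDatum.gl n K hcpt).arch.carrier) :
    GLn.archHeight n K ((AutomorphyDatum.gl n K hcpt).ofArch g⁻¹) =
      GLn.archHeight n K ((AutomorphyDatum.gl n K hcpt).ofArch g) := by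
  unfold GLn.archHeight
  rw [toMixed_ofArch, toMixed_ofArch, Subgroup.coe_inv, inv_inv]
  congr 1
  funext ij
  rw [sup_comm]

/-- `a sⁱ ≤ a sʳ` for `s ≥ 1`, `a ≥ 0`, `i ≤ r`. [folklore] -/
theorem mul_pow_le_mul_pow_of_le {s a : ℝ} {i r : ℕ} (hs : 1 ≤ s) (ha : 0 ≤ a) (hir : i ≤ r) :
    a * s ^ i ≤ a * s ^ r :=
  mul_le_mul_of_nonneg_left (pow_le_pow_right₀ hs hir) ha

/-- A product of `q` factors each bounded by `B` (and non-negative) is bounded by `B^q`. [folklore] -/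
theorem prod_norm_le_pow {q : ℕ} {V : Type*} [SeminormedAddCommGroup V] (t : Fin q → V) {B : ℝ}
    (h : ∀ i, ‖t i‖ ≤ B) : ∏ i, ‖t i‖ ≤ B ^ q := by
  calc ∏ i, ‖t i‖ ≤ ∏ _i : Fin q, B := Finset.prod_le_prod (fun i _ => norm_nonneg _) fun i _ => h i
    _ = B ^ q := by rw [Finset.prod_const, Finset.card_univ, Fintype.card_fin]

end ResGLnCone

end Literature.NumberTheory.Automorphic

end
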